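import Literature.Geometry.Kaehler.RiemannSurfaceChevalleyWeilBranchValues
import HarnessLib

/-!
# The Chevalley–Weil formula for one-dimensional characters: the multiplicity of `χ ≠ 1` in `𝓗¹(M)` is
# `γ − 1 + Σ_t u_t/m_t` (Kopeliovich–Zemel Proposition 7.1, `t_χ = Σ_C r_C u_{χ,C}/o(C)`)

Layer `Literature/Geometry/Kaehler`, sequel of `RiemannSurfaceChevalleyWeilFormula` and
`RiemannSurfaceChevalleyWeilBranchValues` (the Chevalley–Weil formula for an arbitrary representation `V` of
`G ≤ Aut M`, as a sum over ramification points and grouped over the branch values), specialised to ONE-DIMENSIONAL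
representations (characters `χ ∈ Ĝ`; the case of abelian covers). S. Kopeliovich, S. Zemel, Israel J. Math. 234
(2019), as printed (arXiv copy pp. 8, 10, 30):

> For any `χ ∈ Ĝ` and conjugacy class `C ⊆ G` we define `u_{χ,C}` to be the unique integer determined by the
> conditions `0 ≤ u_{χ,C} < o(C)` and `χ(C) = ζ_{o(C)}^{u_{χ,C}}`. […] we set `t_χ = Σ_C r_C u_{χ,C}/o(C)`, where `C` runs
> over the conjugacy classes in `G` […]
> **Proposition 7.1.** […] In particular, each character `1 ≠ χ ∈ Ĝ` appears in `ρ_a` precisely `g_S + t_χ − 1` times,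
> while the multiplicity of `1` in that representation is `g_S`.

For a one-dimensional `(V, ρ)`, `ρ(h)` is the scalar `χ(h) = tr ρ(h)` and the local multiplicities of the general
formula collapse: `N_{P,α} = [χ(g_P) = a_P(g_P)^α]`, so `Σ_α α·N_{P,α} = u_P`, the unique exponent `0 ≤ u_P < m_P` with
`χ(g_P) = a_P(g_P)^{u_P}` (`exists_trace_eq_stabDeriv_pow`; with the tree's `a_P` and action `Tφ = (T⁻¹)^*φ` — the
source's `u_{χ,C}` is taken with respect to `ζ_{o(C)}` and its generator `ψ(P)`, and Proposition 7.1 is about the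
dual `ρ_a`; the statement proved here is the tree-normalised one). Hence

  `Σ_{h ∈ G} tr(h⁻¹|𝓗¹(M))·χ(h) = |G|·(dim ℂ_χ^G + γ − 1) + Σ_{P : G_P ≠ 1} u_P`, and, over the branch values,
  `|G|⁻¹ Σ_h tr(h|𝓗¹)χ(h⁻¹) = dim ℂ_χ^G + (γ − 1) + Σ_{q ∈ Br} u_q/r_q`

(`dim ℂ_χ^G = δ_{χ,1}`), i.e. the multiplicity of `χ ≠ 1` in `𝓗¹(M)` is `γ − 1 + Σ_q u_q/r_q` and that of `1` is `γ`.

## What is formalized (everything proved; no definitions, no named facts, no instances)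

* `apply_eq_trace_smul_of_finrank_eq_one` (`ρ(h) = χ(h)·id`), `finrank_eigenspace_of_finrank_eq_one`,
  **`sum_mul_finrank_eigenspace_eq_of_finrank_eq_one`** (`Σ_α α N_{P,α} = u_P`), **`exists_trace_eq_stabDeriv_pow`**
  (existence and uniqueness of `u_P < m_P`), **`chevalleyWeil_character`** (sum over ramification points),
  **`chevalleyWeil_character_multiplicity_eq_sum_branchValues`** (`= dim ℂ_χ^G + (γ − 1) + Σ_q u_q/r_q`).

## References

* S. Kopeliovich, S. Zemel, *On spaces associated with invariant divisors on Galois covers of Riemann surfaces and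
  their applications*, Israel J. Math. 234 (2019): §1 (`u_{χ,C}`), §2 before Corollary 2.5 (`t_χ`), Proposition 7.1
  (arXiv:1609.02296 pp. 8, 10, 30). [KopeliovichZemel2019]
* C. Chevalley, A. Weil, Abh. Math. Sem. Hamburg 10 (1934), 358–361. [ChevalleyWeil1934Integrale]
-/

noncomputable section

open scoped Manifold ContDiff Topology
open Set Filter Function Complex MulAction Module

namespace Literature.Geometry.Kaehler

namespace RiemannSurface

section Characters

variable {M : Type*} [TopologicalSpace M] [ChartedSpace ℂ M] [IsManifold 𝓘(ℂ, ℂ) ω M]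
  [CompactSpace M] [T2Space M] [PreconnectedSpace M] [Nonempty M] [Finite (autGroup M)]
  (G : Subgroup (autGroup M)) {V : Type*} [AddCommGroup V] [Module ℂ V] (ρ : Representation ℂ ↥G V)

open OrbitSurface

omit [IsManifold 𝓘(ℂ, ℂ) ω M] [CompactSpace M] [T2Space M] [PreconnectedSpace M] [Nonempty M] [Finite ↥(autGroup M)] in
/-- On a one-dimensional representation every `ρ(h)` is the scalar `χ(h) = tr ρ(h)`.
[cite: KopeliovichZemel2019, §1 («`ℂ(X)_χ` … `χ ∈ Ĝ`»)] -/
theorem apply_eq_trace_smul_of_finrank_eq_one (hV : finrank ℂ V = 1) (h : ↥G) (v : V) :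
    ρ h v = LinearMap.trace ℂ V (ρ h) • v := by
  haveI : FiniteDimensional ℂ V := .of_finrank_eq_succ hV
  obtain ⟨c, hc⟩ : ∃ c : ℂ, ρ h = c • LinearMap.id := by
    obtain ⟨w, hw⟩ := finrank_eq_one_iff'.1 hV
    obtain ⟨c, hcw⟩ := hw.2 (ρ h w)
    refine ⟨c, LinearMap.ext fun v ↦ ?_⟩
    obtain ⟨a, ha⟩ := hw.2 v
    rw [← ha, map_smul, ← hcw, LinearMap.smul_apply, LinearMap.id_apply, smul_comm]
  rw [hc, map_smul, LinearMap.trace_id, hV, Nat.cast_one, smul_eq_mul, mul_one, LinearMap.smul_apply,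
    LinearMap.id_apply]

omit [IsManifold 𝓘(ℂ, ℂ) ω M] [CompactSpace M] [T2Space M] [PreconnectedSpace M] [Nonempty M] [Finite ↥(autGroup M)] in
/-- For a one-dimensional representation the eigenspace of `ρ(h)` for `μ` is everything or nothing according as
`μ = χ(h)` or not. [cite: KopeliovichZemel2019, Theorem 6.6 (preamble)] -/
theorem finrank_eigenspace_of_finrank_eq_one (hV : finrank ℂ V = 1) (h : ↥G) (μ : ℂ) :
    finrank ℂ ↥(Module.End.eigenspace (ρ h) μ) = if μ = LinearMap.trace ℂ V (ρ h) then 1 else 0 := by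
  haveI : FiniteDimensional ℂ V := .of_finrank_eq_succ hV
  split_ifs with hμ
  · have htop : Module.End.eigenspace (ρ h) μ = ⊤ := by
      rw [eq_top_iff]
      intro v _
      rw [Module.End.mem_eigenspace_iff, apply_eq_trace_smul_of_finrank_eq_one G ρ hV, hμ]
    rw [htop, finrank_top, hV]
  · have hbot : Module.End.eigenspace (ρ h) μ = ⊥ := by
      rw [Submodule.eq_bot_iff]
      intro v hv
      rw [Module.End.mem_eigenspace_iff, apply_eq_trace_smul_of_finrank_eq_one G ρ hV] at hv
      by_contra hv0
      exact hμ (smul_left_injective ℂ hv0 hv).symm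
    rw [hbot, finrank_bot]

omit [CompactSpace M] [Nonempty M] in
/-- **The local exponent `u_P(χ)` of a character at a ramification point**: for a one-dimensional representation
`χ` and a generator `g` of `G_P` (`m = |G_P|`, `ε = a_P(g)`), there is a unique `u < m` with `χ(g) = ε^u`, and then
`Σ_{α<m} α·N_{P,α} = u` («`u_{χ,C}` … the unique integer determined by the conditions `0 ≤ u_{χ,C} < o(C)` and
`χ(C) = ζ_{o(C)}^{u_{χ,C}}`»). [cite: KopeliovichZemel2019, §1 (definition of `u_{χ,C}`), Theorem 6.6] -/
theorem sum_mul_finrank_eigenspace_eq_of_finrank_eq_one (hV : finrank ℂ V = 1) {P : M} {g : ↥G} (hg : g • P = P)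
    (hgen : ∀ w : stabilizer G P, w ∈ Subgroup.zpowers (⟨g, mem_stabilizer_iff.2 hg⟩ : stabilizer G P))
    {u : ℕ} (hu : u < Nat.card (stabilizer G P)) (hχ : LinearMap.trace ℂ V (ρ g) = stabDeriv P g ^ u) :
    ∑ α ∈ Finset.range (Nat.card (stabilizer G P)),
        (α : ℂ) * finrank ℂ ↥(Module.End.eigenspace (ρ g) (stabDeriv P g ^ α)) = u := by
  have hε := isPrimitiveRoot_stabDeriv_of_forall_mem_zpowers G hg hgen
  rw [Finset.sum_eq_single_of_mem u (Finset.mem_range.2 hu)]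
  · rw [finrank_eigenspace_of_finrank_eq_one G ρ hV, hχ, if_pos rfl, Nat.cast_one, mul_one]
  · intro α hα hαu
    rw [finrank_eigenspace_of_finrank_eq_one G ρ hV, hχ, if_neg, Nat.cast_zero, mul_zero]
    exact fun h ↦ hαu (hε.pow_inj (Finset.mem_range.1 hα) hu h)

omit [CompactSpace M] [Nonempty M] in
/-- **Existence of the local exponent**: `χ(g) = a_P(g)^u` for a unique `u < |G_P|` (`χ(g)` is a `|G_P|`-th root of
unity, `a_P(g)` a primitive one). [cite: KopeliovichZemel2019, §1 (definition of `u_{χ,C}`)] -/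
theorem exists_trace_eq_stabDeriv_pow (hV : finrank ℂ V = 1) {P : M} {g : ↥G} (hg : g • P = P)
    (hgen : ∀ w : stabilizer G P, w ∈ Subgroup.zpowers (⟨g, mem_stabilizer_iff.2 hg⟩ : stabilizer G P)) :
    ∃! u : ℕ, u < Nat.card (stabilizer G P) ∧ LinearMap.trace ℂ V (ρ g) = stabDeriv P g ^ u := by
  haveI : FiniteDimensional ℂ V := .of_finrank_eq_succ hV
  have hε := isPrimitiveRoot_stabDeriv_of_forall_mem_zpowers G hg hgen
  haveI : NeZero (Nat.card (stabilizer G P)) := ⟨Nat.card_pos.ne'⟩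
  -- `χ(g)^m = 1`
  have hpow : LinearMap.trace ℂ V (ρ g) ^ Nat.card (stabilizer G P) = 1 := by
    have h1 := map_pow_card_stabilizer_eq_one G ρ hg
    obtain ⟨w, hw⟩ := finrank_eq_one_iff'.1 hV
    have h2 : (ρ g ^ Nat.card (stabilizer G P)) w = w := by rw [h1, Module.End.one_apply]
    have h3 : ∀ n : ℕ, (ρ g ^ n) w = LinearMap.trace ℂ V (ρ g) ^ n • w := by
      intro n
      induction n with
      | zero => simp
      | succ n ih =>
        rw [pow_succ, Module.End.mul_apply, apply_eq_trace_smul_of_finrank_eq_one G ρ hV, map_smul, ih, smul_smul,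
          pow_succ']
    rw [h3] at h2
    have h4 : (LinearMap.trace ℂ V (ρ g) ^ Nat.card (stabilizer G P) - 1) • w = 0 := by rw [sub_smul, one_smul, h2, sub_self]
    exact sub_eq_zero.1 ((smul_eq_zero.1 h4).resolve_right hw.1)
  obtain ⟨u, hu, huε⟩ := hε.eq_pow_of_pow_eq_one hpow
  refine ⟨u, ⟨hu, huε.symm⟩, fun u' hu' ↦ hε.pow_inj hu'.1 hu (by rw [← hu'.2, huε])⟩

open Classical in
/-- **THE CHEVALLEY–WEIL FORMULA FOR A ONE-DIMENSIONAL CHARACTER `χ`** (with chosen generators `g_P` of the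
stabilizers and the local exponents `u_P`, `χ(g_P) = a_P(g_P)^{u_P}`, `0 ≤ u_P < |G_P|`):
`Σ_{h ∈ G} tr(h⁻¹|𝓗¹(M))·χ(h) = |G|·(dim ℂ_χ^G + γ − 1) + Σ_{P : G_P ≠ 1} u_P`, so the multiplicity of `χ` in `𝓗¹(M)` is
`δ_{χ,1} + γ − 1 + |G|⁻¹ Σ_P u_P = δ_{χ,1} + γ − 1 + Σ_t u_t/m_t` («each character `1 ≠ χ ∈ Ĝ` appears … precisely
`g_S + t_χ − 1` times», `t_χ = Σ_C r_C u_{χ,C}/o(C)`, in the source's indexing). [cite: KopeliovichZemel2019, Proposition 7.1,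
Corollary 2.5 (`t_χ`)] [cite: ChevalleyWeil1934Integrale] -/
theorem chevalleyWeil_character [Fintype ↥G] [DecidableEq ↥G] (hV : finrank ℂ V = 1) (gen : M → ↥G)
    (hfix : ∀ P ∈ (ramificationDiv (mk G : M → OrbitSurface G M)).support, gen P • P = P)
    (hgen : ∀ P (hP : P ∈ (ramificationDiv (mk G : M → OrbitSurface G M)).support) (w : stabilizer G P),
      w ∈ Subgroup.zpowers (⟨gen P, mem_stabilizer_iff.2 (hfix P hP)⟩ : stabilizer G P))
    (u : M → ℕ) (hu : ∀ P ∈ (ramificationDiv (mk G : M → OrbitSurface G M)).support,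
      u P < Nat.card (stabilizer G P) ∧ LinearMap.trace ℂ V (ρ (gen P)) = stabDeriv P (gen P) ^ u P) :
    ∑ h : ↥G, LinearMap.trace ℂ ↥(holomorphicOneForms M) (oneFormRep M ((h⁻¹ : ↥G) : autGroup M)) *
        LinearMap.trace ℂ V (ρ h) =
      Nat.card ↥G * ((finrank ℂ ↥ρ.invariants : ℂ) + ((arithGenus (OrbitSurface G M) : ℂ) - 1)) +
      ∑ P ∈ (ramificationDiv (mk G : M → OrbitSurface G M)).support, (u P : ℂ) := by
  haveI : FiniteDimensional ℂ V := .of_finrank_eq_succ hV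
  rw [chevalleyWeil_sum_trace_inv_mul_trace_eq G ρ gen hfix hgen, hV, Nat.cast_one, one_mul]
  congr 1
  refine Finset.sum_congr rfl fun P hP ↦ ?_
  exact sum_mul_finrank_eigenspace_eq_of_finrank_eq_one G ρ hV (hfix P hP) (hgen P hP) (hu P hP).1 (hu P hP).2

open Classical in
/-- **THE CHEVALLEY–WEIL FORMULA FOR A CHARACTER, grouped over the branch values** (`r_q` the stabilizer order over
the branch value `q`, `g_q` a generator of the stabilizer of `q.out`, `u_q < r_q` with `χ(g_q) = a(g_q)^{u_q}`):
`|G|⁻¹ Σ_{h ∈ G} tr(h|𝓗¹(M))·χ(h⁻¹) = dim ℂ_χ^G + (γ − 1) + Σ_{q ∈ Br} u_q/r_q` — «`t_χ = Σ_C r_C u_{χ,C}/o(C)`», the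
multiplicity of a non-trivial character `χ` in `𝓗¹(M)` is `γ − 1 + Σ_q u_q/r_q` (the source's `g_S + t_χ − 1`, in its
indexing conventions). [cite: KopeliovichZemel2019, Proposition 7.1, §2 (definition of `t_χ`)]
[cite: ChevalleyWeil1934Integrale] -/
theorem chevalleyWeil_character_multiplicity_eq_sum_branchValues [Fintype ↥G] [DecidableEq ↥G] (hV : finrank ℂ V = 1)
    (gen : OrbitSurface G M → ↥G)
    (hfix : ∀ q ∈ (branchDiv (mk G : M → OrbitSurface G M)).support, gen q • q.out = q.out)
    (hgen : ∀ q (hq : q ∈ (branchDiv (mk G : M → OrbitSurface G M)).support) (w : stabilizer G q.out),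
      w ∈ Subgroup.zpowers (⟨gen q, mem_stabilizer_iff.2 (hfix q hq)⟩ : stabilizer G q.out))
    (u : OrbitSurface G M → ℕ) (hu : ∀ q ∈ (branchDiv (mk G : M → OrbitSurface G M)).support,
      u q < stabOrder q ∧ LinearMap.trace ℂ V (ρ (gen q)) = stabDeriv q.out (gen q) ^ u q) :
    (Nat.card ↥G : ℂ)⁻¹ * ∑ h : ↥G, LinearMap.trace ℂ ↥(holomorphicOneForms M) (oneFormRep M (h : autGroup M)) *
        LinearMap.trace ℂ V (ρ h⁻¹) =
      (finrank ℂ ↥ρ.invariants : ℂ) + ((arithGenus (OrbitSurface G M) : ℂ) - 1) +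
      ∑ q ∈ (branchDiv (mk G : M → OrbitSurface G M)).support, (u q : ℂ) / (stabOrder q : ℂ) := by
  haveI : FiniteDimensional ℂ V := .of_finrank_eq_succ hV
  rw [chevalleyWeil_multiplicity_eq_sum_branchValues G ρ, hV, Nat.cast_one, one_mul]
  congr 1
  refine Finset.sum_congr rfl fun q hq ↦ ?_
  have hfq := hfix q hq
  have hgq := hgen q hq
  have h1 : ∀ α, finrank ℂ ↥(⨅ h : ↥(stabilizer G q.out),
      Module.End.eigenspace (ρ (h : ↥G)) (stabDeriv q.out (h : ↥G) ^ α)) =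
      finrank ℂ ↥(Module.End.eigenspace (ρ (gen q)) (stabDeriv q.out (gen q) ^ α)) := fun α ↦ by
    rw [← eigenspace_eq_iInf_eigenspace_stabDeriv_pow G ρ hfq hgq α]
  simp_rw [h1]
  have h2 := sum_mul_finrank_eigenspace_eq_of_finrank_eq_one G ρ hV hfq hgq
    (u := u q) (by rw [← stabOrder]; exact (hu q hq).1) (hu q hq).2
  -- `stabOrder q = Nat.card (stabilizer G q.out)` by definition
  change ∑ α ∈ Finset.range (Nat.card (stabilizer G q.out)), (α : ℂ) / (Nat.card (stabilizer G q.out) : ℂ) *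
      (finrank ℂ ↥(Module.End.eigenspace (ρ (gen q)) (stabDeriv q.out (gen q) ^ α)) : ℂ) =
    (u q : ℂ) / (Nat.card (stabilizer G q.out) : ℂ)
  rw [← h2, Finset.sum_div]
  refine Finset.sum_congr rfl fun α _ ↦ ?_
  ring

end Characters

end RiemannSurface

end Literature.Geometry.Kaehler

end
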